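import Mathlib
import HarnessLib
import Summits.HubbardSuperconductivity.HubbardSuperconductivity.Theorems.KLProgrammeKLRegimeEngineScaleZeroV17FG7
import Summits.HubbardSuperconductivity.HubbardSuperconductivity.Theorems.KLProgrammeKLRegimeEngineV8DefsQ7
import Summits.HubbardSuperconductivity.HubbardSuperconductivity.Theorems.KLProgrammeKLRegimeEngineV8DefsU9

/-!
# Stub (a) `stub_engine_scale0` of the K3 ENGINE-FLOW child at the FROZEN token set of the 20437 render
# (#7 `klEngGeo7`, #10 `klEngU₀9`, #12 `klEngQ7`; plan g17 (R41d)/(R44))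

Cell `gate-hubbard-kl`, seat hubbard-kl-k3c2-p1 g4 (row «scale-0 Gram step `stub_engine_scale0`»).  The closer at `(klEngGeo7, klEngQ6, klEngU₀6)`
(`stub_engine_scale0_klEng7`, `…ScaleZeroV17FG7`, p530960) lifted along the two remaining tokens: `U ≤ klEngU₀9 P R c ≤ klEngU₀6 P R c`
(`klEngU₀9_le_klEngU₀6`, `…EngineV8DefsU9`) and `klEngQ6 ↦ klEngQ7 := (klEngQ6 P R).raiseCEOnly (klWtCE R)` (`…EngineV8DefsQ7`): of the five conjuncts
only (E1-v4)₀ reads `CE` and it is `CE`-monotone (`kernelNormsV4_klEngQ7_of_klEngQ6`); (E2-F2)₀, (E2′-F UV)₀, (E4)₀ are `Iff.rfl` across the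
raise (`…_klEngQ7_iff`), (E5-F)₀ does not read `Q`.

* §0 `scaleZeroConjV17F2_mono_Q` — the five-clause conclusion of stub (a) is MONOTONE in the engine package `Q` through the three fields it
  reads (`CE` for (E1-v4)₀, `CR` for the `legDressBarQ2` tolerance of (E2-F2)₀/(E2′-F UV)₀, `cE4` for (E4)₀): any future `Q`-raise of the skeleton
  (e.g. v2's token #13 `klEngQ7 ↦ klEngQ8`, `CR` only) lifts the stub-(a) closer by ONE application;
* `stub_engine_scale0_klEng7Q7` — stub (a) at `(klEngGeo7, klEngQ7 P R, klEngC₃6, klEngU₀6)`;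
* **`stub_engine_scale0_klEng7Q7U9`** — LITERALLY the registered text of stub (a) at the frozen token set, UNCONDITIONAL.
(Stub (b)'s `j = 0` weighted level at `(klEngQ7, klEngU₀9)` — the witness of `WtScaleZeroAt6 klWtT` from p3 g9's export — lives in
`…ScaleZeroKernelNormsWt4Q7`, which imports the analytic chain; this file does not.)

Bookkeeping only; nothing about the model is asserted beyond the cited upstream theorems; nothing asserts superconductivity.
-/

noncomputable section

namespace Summit.HubbardSuperconductivity.HubbardSuperconductivity.Theorems.EngineV8

set_option linter.dupNamespace false -- summit = problem name (single-conjunct summit), D-0017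

open Real Finset Literature.MathematicalPhysics.QuantumLattice Literature.Probability.LatticeModels
open Summit.HubbardSuperconductivity.HubbardSuperconductivity.Theorems.KLRegimeSplit
open Summit.HubbardSuperconductivity.HubbardSuperconductivity.Theorems.KLProgrammeLegKernels

/-! ## §0 The stub-(a) conclusion is monotone in `Q` (fields `CE`, `CR`, `cE4`) -/

section MonoQ

variable {L M : ℕ} [NeZero L] [NeZero M] {G : GeoConsts} {P : SplitConsts} {Q Q' : EngConsts} {β U μ : ℝ} {K : TrigPolyC4v} {n : ℕ}

omit [NeZero M] in
/-- **(E1-v4) is monotone in `CE`** (`0 ≤ Q.CE ≤ Q'.CE`, `0 ≤ P.Klam`). -/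
theorem kernelNormsV4_mono_CE (hCE0 : 0 ≤ Q.CE) (hCE : Q.CE ≤ Q'.CE) (hK : 0 ≤ P.Klam) (h : KernelNormsV4 L M P Q β U μ K n) :
    KernelNormsV4 L M P Q' β U μ K n := by
  intro p hp
  refine (h p hp).trans ?_
  have hε : 0 ≤ epsCoupling P U n := epsCoupling_nonneg' hK U n
  have hpow : Q.CE ^ p ≤ Q'.CE ^ p := pow_le_pow_left₀ hCE0 hCE p
  have h2 : 0 ≤ (epsCoupling P U n) ^ (p - 1) * (2 : ℝ) ^ ((3 * (p : ℤ) - 5) * n) :=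
    mul_nonneg (pow_nonneg hε _) (zpow_nonneg (by norm_num) _)
  calc Q.CE ^ p * (epsCoupling P U n) ^ (p - 1) * (2 : ℝ) ^ ((3 * (p : ℤ) - 5) * n)
      = Q.CE ^ p * ((epsCoupling P U n) ^ (p - 1) * (2 : ℝ) ^ ((3 * (p : ℤ) - 5) * n)) := by ring
    _ ≤ Q'.CE ^ p * ((epsCoupling P U n) ^ (p - 1) * (2 : ℝ) ^ ((3 * (p : ℤ) - 5) * n)) := mul_le_mul_of_nonneg_right hpow h2
    _ = _ := by ring

omit [NeZero L] [NeZero M] in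
/-- `legDressBarQ2` is monotone in `CR` (`0 ≤ P.Klam`). -/
theorem legDressBarQ2_mono_CR (G : GeoConsts) (hCR : Q.CR ≤ Q'.CR) (hK : 0 ≤ P.Klam) (U : ℝ) (m c : ℕ) :
    legDressBarQ2 G P Q U m c ≤ legDressBarQ2 G P Q' U m c := by
  rw [legDressBarQ2_eq, legDressBarQ2_eq]
  have h1 : 0 ≤ ((P.Klam * U) ^ 2 + (P.Klam * |U|) ^ 3) * (c : ℝ) :=
    mul_nonneg (add_nonneg (sq_nonneg _) (pow_nonneg (mul_nonneg hK (abs_nonneg U)) 3)) (Nat.cast_nonneg c)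
  calc Q.CR * ((P.Klam * U) ^ 2 + (P.Klam * |U|) ^ 3) * (c : ℝ) = Q.CR * (((P.Klam * U) ^ 2 + (P.Klam * |U|) ^ 3) * (c : ℝ)) := by ring
    _ ≤ Q'.CR * (((P.Klam * U) ^ 2 + (P.Klam * |U|) ^ 3) * (c : ℝ)) := mul_le_mul_of_nonneg_right hCR h1
    _ = _ := by ring

/-- **(E2-F2)₀ is monotone in `CR`** (at `n = 0` the clause reads `Q` only through `legDressBarQ2 … Q U 0 4`). -/
theorem pairLadderStepAtV17F2_zero_mono_CR (hCR : Q.CR ≤ Q'.CR) (hK : 0 ≤ P.Klam) (h : PairLadderStepAtV17F2 L M G P Q β U μ 0) :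
    PairLadderStepAtV17F2 L M G P Q' β U μ 0 := by
  refine ⟨fun _ Qm k hk k' hk' => (h.1 rfl Qm k hk k' hk').trans ?_, fun h1 => absurd h1 (by norm_num)⟩
  have := legDressBarQ2_mono_CR G hCR hK U 0 4
  linarith

/-- **(E2′-F UV)₀ is monotone in `CR`.** -/
theorem quarticValueUVAtV17F_zero_mono_CR (hCR : Q.CR ≤ Q'.CR) (hK : 0 ≤ P.Klam) (h : QuarticValueUVAtV17F L M G P Q β U μ 0) :
    QuarticValueUVAtV17F L M G P Q' β U μ 0 := by
  intro h0 k₁ hk₁ k₂ hk₂ k₃ hk₃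
  refine (h h0 k₁ hk₁ k₂ hk₂ k₃ hk₃).trans ?_
  have := legDressBarQ2_mono_CR G hCR hK U 0 4
  linarith

/-- **(E4) is monotone in `Q.cE4`** (`0 ≤ P.Klam`). -/
theorem engineFirstMoments_mono_QcE4 (hc : Q.cE4 ≤ Q'.cE4) (hK : 0 ≤ P.Klam) (h : EngineFirstMoments L M G P Q β U μ K n) :
    EngineFirstMoments L M G P Q' β U μ K n := by
  intro Ω i k
  refine (h Ω i k).trans ?_
  have hU := abs_nonneg U
  have h1 : G.cE4 + Q.cE4 * |U| ≤ G.cE4 + Q'.cE4 * |U| := by nlinarith only [hc, hU]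
  have h2 : 0 ≤ P.Klam * |U| * (4 : ℝ) ^ n := by positivity
  calc (G.cE4 + Q.cE4 * |U|) * P.Klam * |U| * (4 : ℝ) ^ n = (G.cE4 + Q.cE4 * |U|) * (P.Klam * |U| * (4 : ℝ) ^ n) := by ring
    _ ≤ (G.cE4 + Q'.cE4 * |U|) * (P.Klam * |U| * (4 : ℝ) ^ n) := mul_le_mul_of_nonneg_right h1 h2
    _ = (G.cE4 + Q'.cE4 * |U|) * P.Klam * |U| * (4 : ℝ) ^ n := by ring

/-- **The five-clause conclusion of stub (a) is monotone in `Q`** through `CE`, `CR`, `cE4` (`0 ≤ Q.CE`, `0 ≤ P.Klam`): every future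
`Q`-raise of the engine-flow skeleton lifts the stub-(a) closer by one application of this lemma. -/
theorem scaleZeroConjV17F2_mono_Q (hCE0 : 0 ≤ Q.CE) (hCE : Q.CE ≤ Q'.CE) (hCR : Q.CR ≤ Q'.CR) (hc : Q.cE4 ≤ Q'.cE4) (hK : 0 ≤ P.Klam)
    (h : KernelNormsV4 L M P Q β U μ (klFlowFrameU L M β U μ 0) 0 ∧ PairLadderStepAtV17F2 L M G P Q β U μ 0 ∧
      QuarticValueUVAtV17F L M G P Q β U μ 0 ∧ EngineFirstMoments L M G P Q β U μ (klFlowFrameU L M β U μ 0) 0 ∧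
        IsoTupleL1AtV17F L M G P β U μ 0) :
    KernelNormsV4 L M P Q' β U μ (klFlowFrameU L M β U μ 0) 0 ∧ PairLadderStepAtV17F2 L M G P Q' β U μ 0 ∧
      QuarticValueUVAtV17F L M G P Q' β U μ 0 ∧ EngineFirstMoments L M G P Q' β U μ (klFlowFrameU L M β U μ 0) 0 ∧
        IsoTupleL1AtV17F L M G P β U μ 0 :=
  ⟨kernelNormsV4_mono_CE hCE0 hCE hK h.1, pairLadderStepAtV17F2_zero_mono_CR hCR hK h.2.1,
    quarticValueUVAtV17F_zero_mono_CR hCR hK h.2.2.1, engineFirstMoments_mono_QcE4 hc hK h.2.2.2.1, h.2.2.2.2⟩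

end MonoQ

/-- **Stub (a) at `(klEngGeo7, klEngQ7 P R, klEngC₃6, klEngU₀6)`** — `stub_engine_scale0_klEng7` lifted along token #12 (`raiseCEOnly`: (E1-v4)₀
monotone in `CE`, the other four conjuncts unchanged). -/
theorem stub_engine_scale0_klEng7Q7 :
    ∀ (P : SplitConsts) (R : RenConsts) (c : ℝ), P.WF → R.WF2 → 0 < c → c ≤ klEngC₃6 P R →
      ∀ μ ∈ klWindowC, ∀ U : ℝ, 0 < U → U ≤ klEngU₀6 P R c → ∀ β : ℝ, klBetaMin ≤ β → β ≤ Real.exp (c / U ^ 2) →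
        ∀ (L M : ℕ) [NeZero L] [NeZero M], klEngL₃ β U ≤ L → klEngM₃ β U L ≤ M →
          FrameOK R U (nScales β) μ (klFlowFrameU L M β U μ 0) →
            KernelNormsV4 L M P (klEngQ7 P R) β U μ (klFlowFrameU L M β U μ 0) 0 ∧
              PairLadderStepAtV17F2 L M klEngGeo7 P (klEngQ7 P R) β U μ 0 ∧
                QuarticValueUVAtV17F L M klEngGeo7 P (klEngQ7 P R) β U μ 0 ∧
                  EngineFirstMoments L M klEngGeo7 P (klEngQ7 P R) β U μ (klFlowFrameU L M β U μ 0) 0 ∧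
                    IsoTupleL1AtV17F L M klEngGeo7 P β U μ 0 := by
  intro P R c hP hR hc hc₆ μ hμ U hU hU₀ β hβ hβc L M _ _ hL hM hK
  obtain ⟨h1, h2, h3, h4, h5⟩ := stub_engine_scale0_klEng7 P R c hP hR hc hc₆ μ hμ U hU hU₀ β hβ hβc L M hL hM hK
  exact ⟨kernelNormsV4_klEngQ7_of_klEngQ6 hP h1, pairLadderStepAtV17F2_klEngQ7_iff.2 h2, quarticValueUVAtV17F_klEngQ7_iff.2 h3,
    engineFirstMoments_klEngQ7_iff.2 h4, h5⟩

/-- **STUB (a) `stub_engine_scale0` OF THE 20437 ENGINE-FLOW SKELETON AT THE FROZEN TOKEN SET — PROVED**: for every `P R c` with `P.WF`,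
`R.WF2`, `0 < c ≤ klEngC₃6 P R`, `μ ∈ klWindowC`, `0 < U ≤ klEngU₀9 P R c`, `klBetaMin ≤ β ≤ e^{c/U²}`, volumes above `klEngL₃ / klEngM₃`,
and the bare flow frame `K₀ = klFlowFrameU L M β U μ 0` admissible: (E1-v4)₀ ∧ (E2-F2)₀ ∧ (E2′-F UV)₀ ∧ (E4)₀ ∧ (E5-F)₀ at
`(klEngGeo7, klEngQ7 P R)`. -/
theorem stub_engine_scale0_klEng7Q7U9 :
    ∀ (P : SplitConsts) (R : RenConsts) (c : ℝ), P.WF → R.WF2 → 0 < c → c ≤ klEngC₃6 P R →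
      ∀ μ ∈ klWindowC, ∀ U : ℝ, 0 < U → U ≤ klEngU₀9 P R c → ∀ β : ℝ, klBetaMin ≤ β → β ≤ Real.exp (c / U ^ 2) →
        ∀ (L M : ℕ) [NeZero L] [NeZero M], klEngL₃ β U ≤ L → klEngM₃ β U L ≤ M →
          FrameOK R U (nScales β) μ (klFlowFrameU L M β U μ 0) →
            KernelNormsV4 L M P (klEngQ7 P R) β U μ (klFlowFrameU L M β U μ 0) 0 ∧
              PairLadderStepAtV17F2 L M klEngGeo7 P (klEngQ7 P R) β U μ 0 ∧
                QuarticValueUVAtV17F L M klEngGeo7 P (klEngQ7 P R) β U μ 0 ∧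
                  EngineFirstMoments L M klEngGeo7 P (klEngQ7 P R) β U μ (klFlowFrameU L M β U μ 0) 0 ∧
                    IsoTupleL1AtV17F L M klEngGeo7 P β U μ 0 :=
  fun P R c hP hR hc hc₆ μ hμ U hU hU₀ β hβ hβc L M _ _ hL hM hK =>
    stub_engine_scale0_klEng7Q7 P R c hP hR hc hc₆ μ hμ U hU (hU₀.trans (klEngU₀9_le_klEngU₀6 P R c)) β hβ hβc L M hL hM hK

end Summit.HubbardSuperconductivity.HubbardSuperconductivity.Theorems.EngineV8

end
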